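import Summits.Ventures.PercRepro.Defs
import Summits.Ventures.PercRepro.Conditioning
import Summits.Ventures.PercRepro.Classical

/-!
# The BK inequality for increasing events (van den Berg–Kesten 1985)

For increasing events `A B : Set (Config E)` on a finite edge set `E`, the disjoint-occurrence
event in open-witness form
`disjOccurRestrict A B = {ω | ∃ K L, Disjoint K L ∧ restrictTo K ω ∈ A ∧ restrictTo L ω ∈ B}`
satisfies `P_p(A □ B) ≤ P_p(A) · P_p(B)` (`bk_restrict`); through
`BKInequality_iff_restrict` this discharges the named Prop `BKInequality E` (`bkInequality`).

**Proof** (van den Berg–Fiebig 1987; Grimmett, *Percolation*, 2nd ed., Thm 2.12).  Work with two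
independent copies `x = (ω, ω')` of the configuration (`weight2`, `prob2`).  For `S ⊆ E` let
`bkMix S x` read the edges of `S` from `ω'` and the others from `ω`, and let `bkEvent A B S` be
the event "`A` occurs on `ω` on some edge set `K`, `B` occurs on `bkMix S x` on some edge set
`L`, and `K ∩ L ⊆ S`" (edges of `S` are read from different copies, so they may be shared).
Then

* `bkEvent A B ∅ = disjOccurRestrict A B × Ω`, so `prob2 = P(A □ B)` (`bkEvent_empty`);
* `bkEvent A B E = A × B`, so `prob2 = P(A) P(B)` (`bkEvent_univ`);
* `prob2 (bkEvent A B S) ≤ prob2 (bkEvent A B (insert e S))` for `e ∉ S`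
  (`prob2_bkEvent_le_insert`): exchanging the values of the two copies at `e` (`swapAt e`) is a
  weight-preserving involution mapping `bkEvent S \ bkEvent (insert e S)` into
  `bkEvent (insert e S) \ bkEvent S` (`swapAt_mem_bkEvent_insert`).

Induction on `S` (`prob2_bkEvent_empty_le`) gives `P(A □ B) ≤ P(A) P(B)`.
-/

namespace PercRepro

open Finset

variable {E : Type*} [Fintype E] [DecidableEq E]

namespace BK

/-! ### Two independent copies -/

/-- The weight of a pair of configurations under two independent copies of the product
Bernoulli law: `weight2 p (ω, ω') = weight p ω · weight p ω'`. -/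
def weight2 (p : E → ℝ) (x : Config E × Config E) : ℝ := weight p x.1 * weight p x.2

/-- Probability of an event of the pair of configurations. -/
noncomputable def prob2 (p : E → ℝ) (C : Set (Config E × Config E)) : ℝ :=
  ∑ x, C.indicator (weight2 p) x

omit [DecidableEq E] in
/-- The pair weight is nonnegative. -/
theorem weight2_nonneg {p : E → ℝ} (hp : IsProb p) (x : Config E × Config E) :
    0 ≤ weight2 p x :=
  mul_nonneg (weight_nonneg hp _) (weight_nonneg hp _)

/-- Splitting a pair event along a second one: `P(C ∩ D) + P(C \ D) = P(C)`. -/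
theorem prob2_inter_add_prob2_diff (p : E → ℝ) (C D : Set (Config E × Config E)) :
    prob2 p (C ∩ D) + prob2 p (C \ D) = prob2 p C := by
  unfold prob2
  rw [← Finset.sum_add_distrib]
  refine Finset.sum_congr rfl fun x _ => ?_
  by_cases hC : x ∈ C <;> by_cases hD : x ∈ D <;> simp [Set.indicator, hC, hD]

/-- The pair probability of `D × Ω` is the probability of `D`. -/
theorem prob2_fst (p : E → ℝ) (D : Set (Config E)) :
    prob2 p {x | x.1 ∈ D} = prob p D := by
  unfold prob2 prob
  rw [Fintype.sum_prod_type]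
  refine Finset.sum_congr rfl fun ω _ => ?_
  by_cases hω : ω ∈ D
  · have hmem : ∀ ω' : Config E, (ω, ω') ∈ {x : Config E × Config E | x.1 ∈ D} := fun _ => hω
    simp only [Set.indicator_of_mem (hmem _), Set.indicator_of_mem hω, weight2]
    rw [← Finset.mul_sum, sum_weight, mul_one]
  · have hmem : ∀ ω' : Config E, (ω, ω') ∉ {x : Config E × Config E | x.1 ∈ D} := fun _ => hω
    simp only [Set.indicator_of_notMem (hmem _), Set.indicator_of_notMem hω, Finset.sum_const_zero]

/-- The pair probability of `A × B` is `P(A) · P(B)` (independence of the two copies). -/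
theorem prob2_prod (p : E → ℝ) (A B : Set (Config E)) :
    prob2 p {x | x.1 ∈ A ∧ x.2 ∈ B} = prob p A * prob p B := by
  unfold prob2 prob
  rw [Fintype.sum_prod_type, Finset.sum_mul_sum]
  refine Finset.sum_congr rfl fun ω _ => Finset.sum_congr rfl fun ω' _ => ?_
  by_cases hω : ω ∈ A <;> by_cases hω' : ω' ∈ B <;> simp [Set.indicator, hω, hω', weight2]

/-! ### The swap involution -/

/-- Exchange the values of the two copies at the edge `e`. -/
def swapAt (e : E) (x : Config E × Config E) : Config E × Config E :=
  (Function.update x.1 e (x.2 e), Function.update x.2 e (x.1 e))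

omit [Fintype E] in
/-- `swapAt e` is an involution. -/
theorem swapAt_swapAt (e : E) (x : Config E × Config E) : swapAt e (swapAt e x) = x := by
  simp [swapAt]

omit [Fintype E] in
/-- `swapAt e` is an involution. -/
theorem swapAt_involutive (e : E) : Function.Involutive (swapAt e) := swapAt_swapAt e

/-- `weightErase p e` ignores the value at `e`. -/
theorem weightErase_update_config (p : E → ℝ) (e : E) (ω : Config E) (b : Bool) :
    weightErase p e (Function.update ω e b) = weightErase p e ω := by
  unfold weightErase
  refine Finset.prod_congr rfl fun e' he' => ?_
  rw [Function.update_of_ne (Finset.mem_erase.1 he').1]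

/-- Exchanging the values of the two copies at one edge preserves the pair weight. -/
theorem weight2_swapAt (p : E → ℝ) (e : E) (x : Config E × Config E) :
    weight2 p (swapAt e x) = weight2 p x := by
  unfold weight2 swapAt
  simp only
  rw [weight_eq_mul_weightErase p e (Function.update x.1 e (x.2 e)),
    weight_eq_mul_weightErase p e (Function.update x.2 e (x.1 e)),
    weight_eq_mul_weightErase p e x.1, weight_eq_mul_weightErase p e x.2,
    weightErase_update_config, weightErase_update_config, Function.update_self,
    Function.update_self]
  ring

/-- Mass transport along a weight-preserving involution `σ`: if `σ` maps `C` into `D`, then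
`P(C) ≤ P(D)`. -/
theorem prob2_le_of_involutive {p : E → ℝ} (hp : IsProb p)
    {σ : Config E × Config E → Config E × Config E} (hσ : Function.Involutive σ)
    (hw : ∀ x, weight2 p (σ x) = weight2 p x) {C D : Set (Config E × Config E)}
    (h : ∀ x ∈ C, σ x ∈ D) : prob2 p C ≤ prob2 p D := by
  unfold prob2
  have h1 : ∑ x, C.indicator (weight2 p) x = ∑ x, C.indicator (weight2 p) (σ x) :=
    Fintype.sum_equiv (hσ.toPerm σ) _ _ fun x => by
      simp only [Function.Involutive.coe_toPerm, hσ x]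
  rw [h1]
  refine Finset.sum_le_sum fun x _ => ?_
  by_cases hx : σ x ∈ C
  · have hxD : x ∈ D := by
      have := h _ hx
      rwa [hσ x] at this
    rw [Set.indicator_of_mem hx, Set.indicator_of_mem hxD, hw]
  · rw [Set.indicator_of_notMem hx]
    exact Set.indicator_nonneg (fun y _ => weight2_nonneg hp y) x

/-! ### The interpolating events -/

/-- The mixed configuration: edges of `S` are read from the second copy, the others from the
first. -/
def bkMix (S : Finset E) (x : Config E × Config E) : Config E :=
  fun e => if e ∈ S then x.2 e else x.1 e

/-- The interpolating event of the van den Berg–Fiebig proof: `A` occurs on the first copy on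
the edge set `K`, `B` occurs on the mixed configuration `bkMix S x` on the edge set `L`, and `K`
and `L` may only share edges of `S`. -/
def bkEvent (A B : Set (Config E)) (S : Finset E) : Set (Config E × Config E) :=
  {x | ∃ K L : Finset E, (∀ e ∈ K, e ∈ L → e ∈ S) ∧
    restrictTo K x.1 ∈ A ∧ restrictTo L (bkMix S x) ∈ B}

omit [Fintype E] in
/-- On `S` the mixed configuration takes the second copy. -/
theorem bkMix_apply_of_mem {S : Finset E} {e : E} (h : e ∈ S) (x : Config E × Config E) :
    bkMix S x e = x.2 e := by
  simp [bkMix, h]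

omit [Fintype E] in
/-- Off `S` the mixed configuration takes the first copy. -/
theorem bkMix_apply_of_notMem {S : Finset E} {e : E} (h : e ∉ S) (x : Config E × Config E) :
    bkMix S x e = x.1 e := by
  simp [bkMix, h]

omit [Fintype E] in
/-- Mixing along no edge returns the first copy. -/
theorem bkMix_empty (x : Config E × Config E) : bkMix ∅ x = x.1 := by
  funext e
  simp [bkMix]

/-- Mixing along every edge returns the second copy. -/
theorem bkMix_univ (x : Config E × Config E) : bkMix univ x = x.2 := by
  funext e
  simp [bkMix]

omit [Fintype E] in
/-- Off `e`, the mixed configurations for `S` and `insert e S` agree. -/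
theorem bkMix_insert_apply_of_ne {S : Finset E} {e e' : E} (h : e' ≠ e)
    (x : Config E × Config E) : bkMix (insert e S) x e' = bkMix S x e' := by
  simp [bkMix, Finset.mem_insert, h]

omit [Fintype E] in
/-- Off `e`, swapping at `e` does not change the mixed configuration. -/
theorem bkMix_swapAt_apply_of_ne (S : Finset E) {e e' : E} (h : e' ≠ e)
    (x : Config E × Config E) : bkMix S (swapAt e x) e' = bkMix S x e' := by
  simp [bkMix, swapAt, Function.update_of_ne h]

/-- Restricting to all edges changes nothing. -/
theorem restrictTo_univ (ω : Config E) : restrictTo univ ω = ω := by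
  funext e
  simp [restrictTo]

omit [Fintype E] in
/-- Two configurations agreeing on `L` have the same restriction to `L`. -/
theorem restrictTo_congr {L : Finset E} {ω₁ ω₂ : Config E} (h : ∀ e ∈ L, ω₁ e = ω₂ e) :
    restrictTo L ω₁ = restrictTo L ω₂ := by
  funext e
  unfold restrictTo
  split_ifs with he
  · exact h e he
  · rfl

omit [Fintype E] in
/-- Restriction is monotone in the configuration. -/
theorem restrictTo_mono {L : Finset E} {ω₁ ω₂ : Config E} (h : ω₁ ≤ ω₂) :
    restrictTo L ω₁ ≤ restrictTo L ω₂ := by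
  intro e
  unfold restrictTo
  split_ifs
  · exact h e
  · exact le_rfl

omit [Fintype E] in
/-- At `S = ∅` the interpolating event is `(A □ B) × Ω`. -/
theorem bkEvent_empty (A B : Set (Config E)) :
    bkEvent A B ∅ = {x | x.1 ∈ disjOccurRestrict A B} := by
  ext x
  constructor
  · rintro ⟨K, L, hKL, hK, hL⟩
    refine ⟨K, L, Finset.disjoint_left.2 fun e heK heL => ?_, hK, ?_⟩
    · simpa using hKL e heK heL
    · rwa [bkMix_empty] at hL
  · rintro ⟨K, L, hKL, hK, hL⟩
    refine ⟨K, L, fun e heK heL => absurd heL (Finset.disjoint_left.1 hKL heK), hK, ?_⟩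
    rwa [bkMix_empty]

/-- At `S = E` the interpolating event is `A × B` (for increasing `A`, `B`). -/
theorem bkEvent_univ {A B : Set (Config E)} (hA : IsUpperSet A) (hB : IsUpperSet B) :
    bkEvent A B univ = {x | x.1 ∈ A ∧ x.2 ∈ B} := by
  ext x
  constructor
  · rintro ⟨K, L, -, hK, hL⟩
    rw [bkMix_univ] at hL
    exact ⟨hA (restrictTo_le K x.1) hK, hB (restrictTo_le L x.2) hL⟩
  · rintro ⟨h1, h2⟩
    refine ⟨univ, univ, fun _ _ _ => mem_univ _, ?_, ?_⟩
    · rwa [restrictTo_univ]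
    · rwa [bkMix_univ, restrictTo_univ]

omit [Fintype E] in
/-- **The one-edge step.** If `x ∈ bkEvent S` but `x ∉ bkEvent (insert e S)`, then the first
copy is open and the second closed at `e`, and swapping the two values at `e` lands in
`bkEvent (insert e S) \ bkEvent S`. -/
theorem swapAt_mem_bkEvent_insert {A B : Set (Config E)} (hA : IsUpperSet A) (hB : IsUpperSet B)
    {S : Finset E} {e : E} (he : e ∉ S) {x : Config E × Config E} (hx : x ∈ bkEvent A B S)
    (hx' : x ∉ bkEvent A B (insert e S)) :
    swapAt e x ∈ bkEvent A B (insert e S) ∧ swapAt e x ∉ bkEvent A B S := by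
  obtain ⟨K, L, hKL, hK, hL⟩ := hx
  have hKL' : ∀ e' ∈ K, e' ∈ L → e' ∈ insert e S :=
    fun e' h1 h2 => Finset.mem_insert_of_mem (hKL e' h1 h2)
  have hoff : ∀ e', e' ≠ e → bkMix (insert e S) x e' = bkMix S x e' :=
    fun e' h => bkMix_insert_apply_of_ne h x
  -- if `e ∉ L`, the witnesses `K, L` also work for `insert e S`
  by_cases heL : e ∈ L
  swap
  · exact absurd ⟨K, L, hKL', hK, by
      rwa [restrictTo_congr fun e' he' => hoff e' fun h => heL (h ▸ he')]⟩ hx'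
  have heK : e ∉ K := fun heK => he (hKL e heK heL)
  have hmixS : bkMix S x e = x.1 e := bkMix_apply_of_notMem he x
  have hmixS' : bkMix (insert e S) x e = x.2 e := bkMix_apply_of_mem (Finset.mem_insert_self e S) x
  -- if the value at `e` does not decrease when passing to the second copy, `K, L` still work
  have hmono : x.1 e ≤ x.2 e → x ∈ bkEvent A B (insert e S) := fun hle =>
    ⟨K, L, hKL', hK, hB (restrictTo_mono fun e' => by
      by_cases h : e' = e
      · rw [h, hmixS, hmixS']
        exact hle
      · rw [hoff e' h]) hL⟩
  have h1 : x.1 e = true := by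
    cases h : x.1 e
    · exact absurd (hmono (by rw [h]; exact Bool.false_le _)) hx'
    · rfl
  have h2 : x.2 e = false := by
    cases h : x.2 e
    · rfl
    · exact absurd (hmono (by rw [h]; exact Bool.le_true _)) hx'
  constructor
  · -- the swapped pair lies in `bkEvent (insert e S)` with the same witnesses
    refine ⟨K, L, hKL', ?_, ?_⟩
    · have hfst : restrictTo K (swapAt e x).1 = restrictTo K x.1 :=
        restrictTo_congr fun e' he' => by
          have hne : e' ≠ e := fun h => heK (h ▸ he')
          exact Function.update_of_ne hne _ _
      rw [hfst]
      exact hK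
    · rw [restrictTo_congr fun e' _ => ?_]
      · exact hL
      by_cases h : e' = e
      · rw [h, bkMix_apply_of_mem (Finset.mem_insert_self e S), hmixS]
        simp [swapAt, h1]
      · rw [bkMix_insert_apply_of_ne h, bkMix_swapAt_apply_of_ne S h]
  · -- if the swapped pair were in `bkEvent S`, its witnesses would put `x` in `bkEvent (insert e S)`
    rintro ⟨K', L', hKL'', hK'', hL''⟩
    apply hx'
    refine ⟨K', L', fun e' h1 h2 => Finset.mem_insert_of_mem (hKL'' e' h1 h2), ?_, ?_⟩
    · refine hA (restrictTo_mono fun e' => ?_) hK''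
      by_cases h : e' = e
      · rw [h]
        simp [swapAt, h2]
      · simp [swapAt, Function.update_of_ne h]
    · rw [restrictTo_congr fun e' _ => ?_]
      · exact hL''
      by_cases h : e' = e
      · rw [h, hmixS', bkMix_apply_of_notMem he]
        simp [swapAt]
      · rw [bkMix_insert_apply_of_ne h, bkMix_swapAt_apply_of_ne S h]

/-- The pair probability of the interpolating event increases when one more edge is read from
the second copy. -/
theorem prob2_bkEvent_le_insert {p : E → ℝ} (hp : IsProb p) {A B : Set (Config E)}
    (hA : IsUpperSet A) (hB : IsUpperSet B) {S : Finset E} {e : E} (he : e ∉ S) :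
    prob2 p (bkEvent A B S) ≤ prob2 p (bkEvent A B (insert e S)) := by
  have h1 := prob2_inter_add_prob2_diff p (bkEvent A B S) (bkEvent A B (insert e S))
  have h2 := prob2_inter_add_prob2_diff p (bkEvent A B (insert e S)) (bkEvent A B S)
  have h3 : prob2 p (bkEvent A B S \ bkEvent A B (insert e S)) ≤
      prob2 p (bkEvent A B (insert e S) \ bkEvent A B S) :=
    prob2_le_of_involutive hp (swapAt_involutive e) (weight2_swapAt p e)
      fun x hx => swapAt_mem_bkEvent_insert hA hB he hx.1 hx.2
  rw [Set.inter_comm] at h2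
  linarith

/-- Reading any set of edges from the second copy can only increase the pair probability. -/
theorem prob2_bkEvent_empty_le {p : E → ℝ} (hp : IsProb p) {A B : Set (Config E)}
    (hA : IsUpperSet A) (hB : IsUpperSet B) (S : Finset E) :
    prob2 p (bkEvent A B ∅) ≤ prob2 p (bkEvent A B S) := by
  induction S using Finset.induction_on with
  | empty => exact le_rfl
  | insert e S he ih => exact ih.trans (prob2_bkEvent_le_insert hp hA hB he)

end BK

/-- **BK inequality** (van den Berg–Kesten 1985) for increasing events, open-witness form:
`P_p(A □ B) ≤ P_p(A) · P_p(B)`. -/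
theorem bk_restrict {p : E → ℝ} (hp : IsProb p) {A B : Set (Config E)} (hA : IsUpperSet A)
    (hB : IsUpperSet B) : prob p (disjOccurRestrict A B) ≤ prob p A * prob p B := by
  have h := BK.prob2_bkEvent_empty_le hp hA hB univ
  rwa [BK.bkEvent_empty, BK.bkEvent_univ hA hB, BK.prob2_fst, BK.prob2_prod] at h

/-- **The BK inequality holds** on every finite edge type: the named Prop `BKInequality E` of
`Summits.Ventures.PercRepro.Classical` is a theorem. -/
theorem bkInequality : BKInequality E :=
  BKInequality_iff_restrict.2 fun _ hp _ _ hA hB => bk_restrict hp hA hB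

end PercRepro
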